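import Summits.ResolutionOfSingularities.KangarooAtlas.MizutaniTowerModel
import Mathlib.LinearAlgebra.Dimension.Finite
import Mathlib.LinearAlgebra.FiniteDimensional.Defs
import Mathlib.Algebra.Order.Antidiag.Finsupp
import Mathlib.Data.Finsupp.Interval
import HarnessLib

/-!
# Mizutani's conjecture `m(e) = 2p^e − 1` — the abstract profile operators `E_T` and the VERTEX BOUND

Cell topic `Summits/ResolutionOfSingularities/KangarooAtlas` (pub-rosobs); namespace
`Summit.ResolutionOfSingularities.KangarooAtlas.Mizutani`.  Part of the Lean transcription of the
in-house note MIZUTANI-PROOF-g59 (AI-written, AI-audited, NOT refereed by a human expert; *AI review is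
weaker than expert review*); nothing here is a resolution theorem.

## The abstract layer (encloser-1's ARCH-e1 §1–§2)

The note's profile `σ^L_i(ω)` of an element `ω = Σ_M κ_M t^M` of Oda's ring `R = k ⊗_L k = k[t]/(t^q)`
(MIZUTANI-PROOF-g59 §1.4) only ever sees the LEFT-coefficient expansion of `ω` and the operators
`(D^{(T)} ⊗ 1)`, whose action is `(D^{(T)} ⊗ 1)(κ t^M) = Σ_{T₁+T₂=T} C(M,T₂) D^{(T₁)}(κ) t^{M−T₂}`
(§1.4 MONOMIALS and the Leibniz rule; `MizutaniTowerModel.hsOp_monomial` in the polynomial model).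
This file therefore works with

* ANY commutative ring / field `k` of coefficients and ANY family `D : (ι →₀ ℕ) → (k →+ k)` of additive
  operators ("abstract Hasse–Schmidt data"; in a tower `k ⊃ L` these are the Hasse–Schmidt operators of a
  `p`-basis, in the polynomial model they are `hasseDeriv`);
* `opE D T f` — the operator `E_T` on `MvPolynomial ι k` given by the displayed formula;
* `eSpan D i f = span_k {E_T f : |T| ≤ i}` and `eProfile D i f` its dimension (`σ^L_i`, §1.4 via (P1)).

Main result: the **VERTEX BOUND** `card_vertexIndex_le_eProfile` — if `P` is the unique minimiser of a
strictly positive weight `w` on the support of `f`, then the `E_T f` for `T ≤ P`, `|T| ≤ i`, `C(P,T) ≠ 0 in k`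
are linearly independent (their `w`-leading coefficients sit at the distinct monomials `X^{P−T}`), so
`eProfile D i f ≥ #{T ≤ P : |T| ≤ i, C(P,T) ≠ 0}` (by Lucas, `T ≤_d P`).  Only `D 0 = id` is used.  This
replaces Theorem D and Corollary D‴ of the note (torus degeneration at an exposed vertex) by an exact
leading-term computation valid for every coefficient field, with no genericity and no unit constant terms.

References: [Mizutani1973HironakaGroupSchemes] (Remark 2.10, the conjecture; in-house proof §1.4, §5);
[Oda1983HironakaGroupSchemeII] §1 (p. 1166); [EGAIV4] Thm. 16.11.2 (the `D^{(T)}`).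
-/

open MvPolynomial

namespace Summit.ResolutionOfSingularities.KangarooAtlas.Mizutani

/-! ## Weighted degrees of exponent vectors -/

section Weights

variable {ι : Type*} [Fintype ι]

/-- The weighted degree `w · M = Σ_i w_i M_i` of an exponent vector.
[cite: Mizutani1973HironakaGroupSchemes, Remark 2.10 (in-house proof §5, weights w ∈ ℤ^s_{>0})] -/
def wdeg (w : ι → ℕ) (M : ι →₀ ℕ) : ℕ := ∑ i, w i * M i

/-- `w · (A + B) = w · A + w · B`. [folklore] -/
theorem wdeg_add (w : ι → ℕ) (A B : ι →₀ ℕ) : wdeg w (A + B) = wdeg w A + wdeg w B := by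
  simp only [wdeg, Finsupp.add_apply, mul_add, Finset.sum_add_distrib]

/-- `A ≤ B ⇒ w · A ≤ w · B`. [folklore] -/
theorem wdeg_mono (w : ι → ℕ) {A B : ι →₀ ℕ} (h : A ≤ B) : wdeg w A ≤ wdeg w B :=
  Finset.sum_le_sum fun i _ => Nat.mul_le_mul_left _ (h i)

/-- For a strictly positive weight, `A ≤ B` and `w · A = w · B` force `A = B`. [folklore] -/
theorem eq_of_le_of_wdeg_eq (w : ι → ℕ) (hw : ∀ i, 0 < w i) {A B : ι →₀ ℕ} (h : A ≤ B)
    (heq : wdeg w A = wdeg w B) : A = B := by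
  have hBA : A + (B - A) = B := add_tsub_cancel_of_le h
  have h2 : wdeg w (B - A) = 0 := by
    have := wdeg_add w A (B - A)
    rw [hBA] at this
    omega
  ext i
  have h3 : w i * (B - A) i = 0 := Finset.sum_eq_zero_iff.mp h2 i (Finset.mem_univ i)
  rcases Nat.mul_eq_zero.mp h3 with h0 | h0
  · exact absurd h0 (hw i).ne'
  · rw [Finsupp.tsub_apply] at h0
    have hi := h i
    omega

end Weights

/-! ## The operators `E_T` for abstract Hasse–Schmidt data -/

section Operators

variable {ι : Type*} {k : Type*} [CommRing k]

/-- **The profile operator `E_T`** for abstract Hasse–Schmidt data `D` (a family of additive operators on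
the coefficient ring): `E_T (Σ_M κ_M X^M) = Σ_M Σ_{T₁+T₂=T} C(M,T₂) · D_{T₁}(κ_M) · X^{M−T₂}` — the
left-coefficient form of `(D^{(T)} ⊗ 1)` on `k ⊗_L k = k[t]/(t^q)` (MIZUTANI-PROOF-g59 §1.4; for the
polynomial model this is `hsOp`, cf. `MizutaniTowerModel.hsOp_monomial`).
[cite: EGAIV4, Thm. 16.11.2 (16.11.2.1)–(16.11.2.2)] -/
noncomputable def opE [DecidableEq ι] (D : (ι →₀ ℕ) → k →+ k) (T : ι →₀ ℕ)
    (f : MvPolynomial ι k) : MvPolynomial ι k :=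
  ∑ M ∈ f.support, ∑ x ∈ Finset.antidiagonal T,
    monomial (M - x.2) ((mchoose M x.2 : k) * D x.1 (coeff M f))

/-- **Coefficient formula** for `E_T`:
`coeff_N (E_T f) = Σ_{M ∈ supp f} Σ_{T₁+T₂=T} [M − T₂ = N] C(M,T₂) D_{T₁}(κ_M)`.
[cite: EGAIV4, Thm. 16.11.2 (16.11.2.1)–(16.11.2.2)] -/
theorem coeff_opE [DecidableEq ι] (D : (ι →₀ ℕ) → k →+ k) (T N : ι →₀ ℕ) (f : MvPolynomial ι k) :
    coeff N (opE D T f) = ∑ M ∈ f.support, ∑ x ∈ Finset.antidiagonal T,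
      if M - x.2 = N then (mchoose M x.2 : k) * D x.1 (coeff M f) else 0 := by
  simp only [opE, coeff_sum, coeff_monomial]

end Operators

/-! ## The vertex computation -/

section Vertex

variable {ι : Type*} [Fintype ι] [DecidableEq ι] {k : Type*} [CommRing k]

/-- **Leading coefficients below a vertex.**  If `P` is the unique minimiser of a strictly positive weight
`w` on the support of `f` and `D 0 = id`, then for `T, T₀ ≤ P` with `w·T ≤ w·T₀` the coefficient of
`X^{P−T₀}` in `E_T f` is `κ_P · C(P,T₀)` if `T = T₀` and `0` otherwise (the `w`-leading term of `E_T f` is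
`κ_P C(P,T) X^{P−T}`).  MIZUTANI-PROOF-g59 §5 (initial forms), in the exact form of encloser-1 ARCH-e1 (V).
[cite: Mizutani1973HironakaGroupSchemes, Remark 2.10 (in-house proof §5, Thm D / Cor D‴)] -/
theorem coeff_opE_vertex (D : (ι →₀ ℕ) → k →+ k) (hD0 : D 0 = AddMonoidHom.id k)
    (f : MvPolynomial ι k) (w : ι → ℕ) (hw : ∀ i, 0 < w i) (P : ι →₀ ℕ)
    (hmin : ∀ M ∈ f.support, M ≠ P → wdeg w P < wdeg w M)
    {T₀ T : ι →₀ ℕ} (hT₀ : T₀ ≤ P) (hle : wdeg w T ≤ wdeg w T₀) :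
    coeff (P - T₀) (opE D T f) = if T = T₀ then coeff P f * (mchoose P T₀ : k) else 0 := by
  rw [coeff_opE]
  -- the only possibly nonzero term is `M = P`, `x = (0, T)`, and it needs `T = T₀`
  have key : ∀ M ∈ f.support, ∀ x ∈ Finset.antidiagonal T,
      (if M - x.2 = P - T₀ then (mchoose M x.2 : k) * D x.1 (coeff M f) else 0) ≠ 0 →
        M = P ∧ x = (0, T) ∧ T = T₀ := by
    intro M hM x hx hne
    rw [Finset.mem_antidiagonal] at hx
    split_ifs at hne with hEq
    · have hmc : mchoose M x.2 ≠ 0 := by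
        intro h0
        rw [h0, Nat.cast_zero, zero_mul] at hne
        exact hne rfl
      have hx2M : x.2 ≤ M := by
        by_contra h
        exact hmc (mchoose_eq_zero_of_not_le h)
      have hx2T : x.2 ≤ T := by rw [← hx]; exact le_add_self
      have hM' : M = (P - T₀) + x.2 := by rw [← hEq, tsub_add_cancel_of_le hx2M]
      have hsum : wdeg w M + wdeg w T₀ = wdeg w P + wdeg w x.2 := by
        have h1 := wdeg_add w (P - T₀) T₀
        rw [tsub_add_cancel_of_le hT₀] at h1
        rw [hM', wdeg_add]
        omega
      have hwx : wdeg w x.2 ≤ wdeg w T := wdeg_mono w hx2T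
      have hMP : M = P := by
        by_contra hne'
        have := hmin M hM hne'
        omega
      subst hMP
      have hx2 : x.2 = T := eq_of_le_of_wdeg_eq w hw hx2T (by omega)
      refine ⟨rfl, ?_, ?_⟩
      · have hx1 : x.1 = 0 := by
          have := hx
          rw [hx2] at this
          exact add_eq_right.mp this
        exact Prod.ext hx1 hx2
      · -- `M - T = M - T₀` with both `≤ M`
        have hTP : T ≤ M := hx2 ▸ hx2M
        have h3 : M - T = M - T₀ := hx2 ▸ hEq
        have h4 : M - T₀ + T₀ = M - T₀ + T := by
          rw [tsub_add_cancel_of_le hT₀, ← h3, tsub_add_cancel_of_le hTP]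
        exact (add_left_cancel h4).symm
    · exact absurd rfl hne
  by_cases hTT : T = T₀
  · subst hTT
    rw [if_pos rfl]
    by_cases hP : P ∈ f.support
    · rw [Finset.sum_eq_single P, Finset.sum_eq_single ((0 : ι →₀ ℕ), T)]
      · rw [if_pos rfl, hD0, AddMonoidHom.id_apply, mul_comm]
      · intro x hx hne
        by_contra h
        exact hne (key P hP x hx h).2.1
      · intro h
        exact absurd (Finset.mem_antidiagonal.mpr (zero_add T)) h
      · intro M hM hne
        refine Finset.sum_eq_zero fun x hx => ?_
        by_contra h
        exact hne (key M hM x hx h).1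
      · intro h
        exact absurd hP h
    · rw [Finset.sum_eq_zero]
      · rw [notMem_support_iff.mp hP, zero_mul]
      · intro M hM
        refine Finset.sum_eq_zero fun x hx => ?_
        by_contra h
        exact hP ((key M hM x hx h).1 ▸ hM)
  · rw [if_neg hTT]
    refine Finset.sum_eq_zero fun M hM => Finset.sum_eq_zero fun x hx => ?_
    by_contra h
    exact hTT (key M hM x hx h).2.2

end Vertex

/-! ## Profiles -/

section Profile

variable {ι : Type*} [Fintype ι] [DecidableEq ι] {k : Type*} [Field k]

/-- The finite set of exponent vectors of total degree `≤ i`. [folklore] -/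
noncomputable def degLE (ι : Type*) [Fintype ι] [DecidableEq ι] (i : ℕ) : Finset (ι →₀ ℕ) :=
  (Finset.Iic (Finsupp.equivFunOnFinite.symm fun _ : ι => i)).filter fun T => T.degree ≤ i

/-- Membership in `degLE`: `|T| ≤ i`. [folklore] -/
theorem mem_degLE {T : ι →₀ ℕ} {i : ℕ} : T ∈ degLE ι i ↔ T.degree ≤ i := by
  unfold degLE
  rw [Finset.mem_filter, Finset.mem_Iic]
  constructor
  · exact fun h => h.2
  · intro h
    refine ⟨?_, h⟩
    intro j
    rw [Finsupp.coe_equivFunOnFinite_symm]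
    exact le_trans (Finsupp.le_degree j T) h

/-- **The profile span** `span_k {E_T f : |T| ≤ i}` (MIZUTANI-PROOF-g59 §1.4, `σ^L_i` through (P1):
the `D^{(T)}` with `|T| ≤ i` span `Diff^i_L(k)` over `k`).
[cite: Mizutani1973HironakaGroupSchemes, Remark 2.10 (in-house proof §1.4, profiles)] -/
noncomputable def eSpan (D : (ι →₀ ℕ) → k →+ k) (i : ℕ) (f : MvPolynomial ι k) :
    Submodule k (MvPolynomial ι k) :=
  Submodule.span k ((fun T => opE D T f) '' (degLE ι i : Set (ι →₀ ℕ)))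

/-- **The profile** `σ_i(f) = dim_k span_k {E_T f : |T| ≤ i}` (MIZUTANI-PROOF-g59 §1.4).
[cite: Mizutani1973HironakaGroupSchemes, Remark 2.10 (in-house proof §1.4, profiles σ^L_i)] -/
noncomputable def eProfile (D : (ι →₀ ℕ) → k →+ k) (i : ℕ) (f : MvPolynomial ι k) : ℕ :=
  Module.finrank k (eSpan D i f)

/-- The profile span is finite-dimensional (a span of finitely many vectors). [folklore] -/
theorem eSpan_finite (D : (ι →₀ ℕ) → k →+ k) (i : ℕ) (f : MvPolynomial ι k) :
    Module.Finite k (eSpan D i f) := by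
  unfold eSpan
  exact Module.Finite.span_of_finite k ((Finset.finite_toSet _).image _)

/-- `E_T f ∈ eSpan D i f` for `|T| ≤ i`. [folklore] -/
theorem opE_mem_eSpan (D : (ι →₀ ℕ) → k →+ k) {i : ℕ} (f : MvPolynomial ι k) {T : ι →₀ ℕ}
    (hT : T.degree ≤ i) : opE D T f ∈ eSpan D i f :=
  Submodule.subset_span ⟨T, Finset.mem_coe.mpr (mem_degLE.mpr hT), rfl⟩

/-- A linearly independent family inside the profile span bounds the profile from below. [folklore] -/
theorem card_le_eProfile_of_linearIndependent (D : (ι →₀ ℕ) → k →+ k) (i : ℕ) (f : MvPolynomial ι k)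
    {α : Type*} [Fintype α] (v : α → MvPolynomial ι k) (hv : LinearIndependent k v)
    (hmem : ∀ a, v a ∈ eSpan D i f) : Fintype.card α ≤ eProfile D i f := by
  let v' : α → eSpan D i f := fun a => ⟨v a, hmem a⟩
  have hv' : LinearIndependent k v' := LinearIndependent.of_comp (eSpan D i f).subtype hv
  haveI := eSpan_finite D i f
  exact LinearIndependent.fintype_card_le_finrank hv'

/-- The index set of the vertex bound: `T ≤ P` with `|T| ≤ i` and `C(P,T) ≠ 0` in `k`
(in characteristic `p`: `T ≤_d P`, Lucas). [folklore] -/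
noncomputable def vertexIndex (k : Type*) [Field k] (P : ι →₀ ℕ) (i : ℕ) : Finset (ι →₀ ℕ) := by
  classical exact (Finset.Iic P).filter fun T => T.degree ≤ i ∧ (mchoose P T : k) ≠ 0

omit [Fintype ι] in
/-- Membership in `vertexIndex`. [folklore] -/
theorem mem_vertexIndex {P T : ι →₀ ℕ} {i : ℕ} :
    T ∈ vertexIndex k P i ↔ T ≤ P ∧ T.degree ≤ i ∧ (mchoose P T : k) ≠ 0 := by
  classical
  unfold vertexIndex
  rw [Finset.mem_filter, Finset.mem_Iic]

/-- **VERTEX BOUND** (encloser-1 ARCH-e1 (V); replaces MIZUTANI-PROOF-g59 Thm D + Cor D‴ at an exposed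
vertex).  If `D 0 = id` and `P` is the unique minimiser of a strictly positive weight on the support of `f`,
then the `E_T f` with `T ≤ P`, `|T| ≤ i`, `C(P,T) ≠ 0` are linearly independent; hence
`eProfile D i f ≥ #{T ≤ P : |T| ≤ i, C(P,T) ≠ 0 in k}`.
[cite: Mizutani1973HironakaGroupSchemes, Remark 2.10 (in-house proof §5 Cor D‴, §6)] -/
theorem linearIndependent_opE_vertex (D : (ι →₀ ℕ) → k →+ k) (hD0 : D 0 = AddMonoidHom.id k)
    (f : MvPolynomial ι k) (w : ι → ℕ) (hw : ∀ i, 0 < w i) (P : ι →₀ ℕ) (hP : P ∈ f.support)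
    (hmin : ∀ M ∈ f.support, M ≠ P → wdeg w P < wdeg w M) (i : ℕ) :
    LinearIndependent k (fun T : vertexIndex k P i => opE D (T : ι →₀ ℕ) f) := by
  classical
  rw [linearIndependent_iff']
  intro S g hsum T₁ hT₁
  by_contra hg
  -- choose `T₀` with `g T₀ ≠ 0` of maximal weight
  obtain ⟨T₀, hT₀S, hmax⟩ := Finset.exists_max_image (S.filter fun T => g T ≠ 0)
    (fun T => wdeg w (T : ι →₀ ℕ)) ⟨T₁, Finset.mem_filter.mpr ⟨hT₁, hg⟩⟩
  have hT₀g : g T₀ ≠ 0 := (Finset.mem_filter.mp hT₀S).2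
  have hT₀P : (T₀ : ι →₀ ℕ) ≤ P := (mem_vertexIndex.mp T₀.2).1
  have h := congrArg (coeff (P - (T₀ : ι →₀ ℕ))) hsum
  rw [coeff_sum, coeff_zero] at h
  rw [Finset.sum_eq_single T₀] at h
  · rw [coeff_smul, coeff_opE_vertex D hD0 f w hw P hmin hT₀P le_rfl, if_pos rfl, smul_eq_mul] at h
    have hc : coeff P f ≠ 0 := mem_support_iff.mp hP
    have hm : (mchoose P (T₀ : ι →₀ ℕ) : k) ≠ 0 := (mem_vertexIndex.mp T₀.2).2.2
    exact hT₀g ((mul_eq_zero.mp h).resolve_right (mul_ne_zero hc hm))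
  · intro T hTS hne
    rw [coeff_smul]
    by_cases hgT : g T = 0
    · rw [hgT, zero_smul]
    · have hle : wdeg w (T : ι →₀ ℕ) ≤ wdeg w (T₀ : ι →₀ ℕ) :=
        hmax T (Finset.mem_filter.mpr ⟨hTS, hgT⟩)
      rw [coeff_opE_vertex D hD0 f w hw P hmin hT₀P hle, if_neg, smul_zero]
      intro hTT
      exact hne (Subtype.ext hTT)
  · intro h0
    exact absurd (Finset.mem_filter.mp hT₀S).1 h0

/-- **VERTEX BOUND, counting form**: `eProfile D i f ≥ #{T ≤ P : |T| ≤ i, C(P,T) ≠ 0 in k}` for the unique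
minimiser `P` of a strictly positive weight on `supp f` (encloser-1 ARCH-e1 (V)).
[cite: Mizutani1973HironakaGroupSchemes, Remark 2.10 (in-house proof §5 Cor D‴, §6)] -/
theorem card_vertexIndex_le_eProfile (D : (ι →₀ ℕ) → k →+ k) (hD0 : D 0 = AddMonoidHom.id k)
    (f : MvPolynomial ι k) (w : ι → ℕ) (hw : ∀ i, 0 < w i) (P : ι →₀ ℕ) (hP : P ∈ f.support)
    (hmin : ∀ M ∈ f.support, M ≠ P → wdeg w P < wdeg w M) (i : ℕ) :
    (vertexIndex k P i).card ≤ eProfile D i f := by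
  rw [← Fintype.card_coe]
  refine card_le_eProfile_of_linearIndependent D i f _
    (linearIndependent_opE_vertex D hD0 f w hw P hP hmin i) fun T => ?_
  exact opE_mem_eSpan D f (mem_vertexIndex.mp T.2).2.1

end Profile

end Summit.ResolutionOfSingularities.KangarooAtlas.Mizutani
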